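import Literature.NumberTheory.LFunctions.NoRealZeroEvenSmallModuliVI
import Literature.NumberTheory.LFunctions.NoRealZeroOddSmallModuliV
import HarnessLib

/-!
# The kernel base of the no-real-zero column, both parities: `NoRealZeroUpTo 402`, unconditionally

Topic `Literature/NumberTheory/LFunctions`; namespace `Literature.NumberTheory.LFunctions`. THEOREMS only.
Joins the even kernel base `436` (`noRealZeroEvenUpTo_436`, `NoRealZeroEvenSmallModuliVI.lean`) and the
odd kernel base `402` (`noRealZeroOddUpTo_402`, `NoRealZeroOddSmallModuliV.lean`: order-two Fekete–Pólya
certificates along induced characters, and Low's grouping of Epstein zeta functions for the discriminants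
`−232, −235, −267, −340, −372, −379, −388` that have none): **`noRealZeroUpTo_402 : NoRealZeroUpTo 402`**
— for every modulus `3 ≤ q ≤ 402`, every primitive quadratic Dirichlet character `χ` mod `q` and every
`σ ∈ (0, 1)`, `L(σ, χ) ≠ 0` — with no named fact (previous both-parity bases: `231`, `266`). The next odd
wall is `d = 403` (`h(−403) = 2`, partner class `(11, 9, 11)` of height `√403/22 < 1`, below the range of
the tree's constant-term remainder bound); the even wall is `437`.

## References

* M. E. Low, *Real zeros of the Dedekind zeta function of an imaginary quadratic field*, Acta Arith. 14
  (1968) 117–140. [Low1968]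
* H. L. Montgomery, R. C. Vaughan, *Multiplicative Number Theory I*, CUP 2007, §11.2.1 Exercises 7–8.
  [MontgomeryVaughan2007]
-/

namespace Literature.NumberTheory.LFunctions

/-- **`NoRealZeroUpTo 402`, both parities, unconditionally** (odd base `402`, even base `436`).
[cite: Low1968, Theorem 5 (via MR 38#4425)] [cite: MontgomeryVaughan2007, §11.2.1 Exercises 7 (g), 8] -/
theorem noRealZeroUpTo_402 : NoRealZeroUpTo 402 :=
  NoRealZeroUpTo.iff_odd_and_even.mpr
    ⟨noRealZeroOddUpTo_402,
      fun q _ hq3 hq χ hquad hprim heven σ hσ0 hσ1 ↦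
        noRealZeroEvenUpTo_436 q hq3 (by omega) χ hquad hprim heven σ hσ0 hσ1⟩

/-- `NoExceptionalZeroUpTo 402 c` for every `c`. [cite: Low1968, Theorem 5 (via MR 38#4425)] -/
theorem noExceptionalZeroUpTo_402 (c : ℝ) : NoExceptionalZeroUpTo 402 c :=
  noRealZeroUpTo_402.noExceptionalZeroUpTo c

/-- The kernel bases of the wide column after this file: both parities to `402`, even to `436`,
odd to `402`. [cite: Low1968, Theorem 5 (via MR 38#4425)] -/
theorem noRealZero_kernelBase_402_436 : NoRealZeroUpTo 402 ∧ NoRealZeroEvenUpTo 436 :=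
  ⟨noRealZeroUpTo_402, noRealZeroEvenUpTo_436⟩

end Literature.NumberTheory.LFunctions
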